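import Literature.Barriers.CriticalPhenomena.WeaklySAWFourDimLogCorrections
import Literature.Probability.RandomPlanarGeometry.BDGS2012Proofs
import Mathlib.MeasureTheory.Constructions.Pi
import Mathlib.MeasureTheory.Measure.Prod
import Mathlib.Analysis.SpecialFunctions.Integrals.Basic
import Mathlib.Analysis.SpecialFunctions.Exponential
import Mathlib.Analysis.SpecificLimits.Normed
import Mathlib.MeasureTheory.Integral.ExpDecay
import HarnessLib

/-!
# The continuous-time weakly self-avoiding walk: proofs towards Lemma A.1 of
# Bauerschmidt–Brydges–Slade 2015 (the elementary half of Theorem 1.2)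

Companion (theorems only, no definitions, no named facts) to
`WeaklySAWFourDimLogCorrections.lean`, whose jump-chain definitions `sojournSet`, `pathIntegral`,
`weightedExpectation`, `survival = c_{g,T}`, `susceptibility = χ(g,ν)`, `criticalNu = ν_c` it
proves things about. Source: R. Bauerschmidt, D. C. Brydges, G. Slade, *Logarithmic correction
for the susceptibility of the 4-dimensional weakly self-avoiding walk: a renormalisation group
analysis*, CMP 337 (2015), arXiv:1403.7422, Appendix A, **Lemma A.1** ("Existence of critical
value"; in the arXiv text dump the appendix is rendered as §9, Lemma 9.0.1): "For all dimensions
`d > 0`, there exists a critical value `ν_c ∈ (-∞, 0]` such that `χ(g,ν) < ∞` iff `ν > ν_c`. For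
`d > 2`, `ν_c ∈ [-2C₀(0)g, 0]`" — vendored as the named fact `CTWSAW.BBS2015_lemA1`; its `d > 2`
clause is the lower inequality of Theorem 1.2 (`CTWSAW.BBS2015_thm12`).

## What is proved here (namespace `Literature.Barriers.CriticalPhenomena.CTWSAW`)

* The sojourn simplex `Δ_k(T) = sojournSet k T`: empty for `T ≤ 0`, measurable, and
  `volume_sojournSet`: `|Δ_k(T)| = T^k/k!` (Fubini, peeling the first sojourn:
  `|Δ_{k+1}(T)| = ∫₀ᵀ |Δ_k(T-a)| da`).
* `pathIntegral_le_volume` (`∫_Δ e^{-gI} ≤ |Δ|` for `g ≥ 0`, since `I ≥ 0` on `Δ`),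
  `pathIntegral_zero_left` (equality at `g = 0`).
* Walk counting in a locally finite graph by the first-step recursion
  (`card_finsetWalkLength_succ`): `≤ D^n` walks of length `n` under degree `≤ D`, exactly `D^n`
  for a `D`-regular graph over any endpoint set containing all endpoints; for `ℤ^d`:
  `degree_zdGraph_eq` (`= 2d`, the content of the named fact
  `Literature.Probability.LatticeModels.card_neighborFinset_zdGraph`) and, with
  `SAW.Zd.mem_box_of_walk` of `BDGS2012Proofs.lean`,
  `sum_card_finsetWalkLength_zdGraph`: `Σ_{x ∈ box d n} #{n-step walks 0 → x} = (2d)^n`.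
* Normalisation of the jump-chain representation: `survival_zero_left` (`c_{0,T} = 1`, i.e.
  `e^{-2dT} Σ_k (2d)^k T^k/k! = 1` — the sanity check that `weightedExpectation` is the law of the
  rate-`2d` walk), `weightedExpectation_le_one`, `survival_le_one` (`c_{g,T} ≤ 1`, `g ≥ 0`).
* The susceptibility: `susceptibility_antitone`, `susceptibility_lt_top` (`χ(g,ν) < ∞` for
  `ν > 0`), hence **`criticalNu_le_zero`** (`ν_c ≤ 0`, the first assertion of Lemma A.1, here for
  every `d` and `g ≥ 0`), `susceptibility_lt_top_of_criticalNu_lt` (`χ < ∞` above `ν_c`) and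
  `susceptibility_eq_top_of_lt_criticalNu` (`χ = ∞` below `ν_c`, given that `{ν | χ < ∞}` is
  bounded below — the input the lower bound `ν_c ≥ -2C₀(0)g` will supply).

Not yet proved (recorded for the discharge of `BBS2015_lemA1` / the lower half of Theorem 1.2):
the Jensen lower bound `c_T ≥ e^{-gE I(T)}` with `E I(T) ≤ 2TC₀(0)`, finiteness of `C₀(0)` for
`d ≥ 3` (transience), and `χ(ν_c) = ∞` (sub-multiplicativity `c_{T+S} ≤ c_T c_S`).

Mathlib anchors: `MeasureTheory.volume_preserving_piFinSuccAbove`, `Measure.prod_apply`,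
`integral_pow`, `NormedSpace.expSeries_div_hasSum_exp`, `ENNReal.ofReal_tsum_of_nonneg`,
`SimpleGraph.finsetWalkLength`, `exp_neg_integrableOn_Ioi`, `Real.sInf_of_not_bddBelow`.
-/

noncomputable section

open MeasureTheory Filter Topology Set Literature.Probability.LatticeModels
open scoped ENNReal BigOperators Nat

namespace Literature.Barriers.CriticalPhenomena.CTWSAW

variable {d : ℕ}

/-! ### The sojourn simplex: emptiness, measurability, volume `T^k/k!` -/

/-- For `T ≤ 0` there are no admissible sojourns. [folklore] -/
theorem sojournSet_eq_empty_of_nonpos {k : ℕ} {T : ℝ} (hT : T ≤ 0) : sojournSet k T = ∅ := by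
  ext s
  simp only [sojournSet, mem_setOf_eq, mem_empty_iff_false, iff_false, not_and, not_lt]
  intro hs
  exact hT.trans (Finset.sum_nonneg fun i _ => (hs i).le)

/-- With no jump, the (unique, empty) sojourn vector is admissible iff `T > 0`. [folklore] -/
theorem sojournSet_zero (T : ℝ) : sojournSet 0 T = if 0 < T then univ else ∅ := by
  ext s
  split_ifs with h <;> simp [sojournSet, h]

/-- The sojourn simplex is (Borel) measurable. [folklore] -/
theorem measurableSet_sojournSet (k : ℕ) (T : ℝ) : MeasurableSet (sojournSet k T) := by
  have h1 : MeasurableSet {s : Fin k → ℝ | ∀ i, 0 < s i} := by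
    have : {s : Fin k → ℝ | ∀ i, 0 < s i} = ⋂ i, {s | 0 < s i} := by ext; simp
    rw [this]
    exact MeasurableSet.iInter fun i => measurableSet_lt measurable_const (measurable_pi_apply i)
  have h2 : MeasurableSet {s : Fin k → ℝ | ∑ i, s i < T} :=
    measurableSet_lt (Finset.measurable_sum _ fun i _ => measurable_pi_apply i) measurable_const
  exact h1.inter h2

/-- Volume of the zero-dimensional simplex. [folklore] -/
theorem volume_sojournSet_zero {T : ℝ} (hT : 0 < T) : volume (sojournSet 0 T) = 1 := by
  rw [sojournSet_zero, if_pos hT, volume_pi, Measure.pi_univ]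
  simp

/-- Peeling off the first sojourn: `|Δ_{k+1}(T)| = ∫_{a > 0} |Δ_k(T - a)| da`. [folklore] -/
theorem volume_sojournSet_succ (k : ℕ) (T : ℝ) :
    volume (sojournSet (k + 1) T) = ∫⁻ a in Ioi (0 : ℝ), volume (sojournSet k (T - a)) := by
  let e := MeasurableEquiv.piFinSuccAbove (fun _ : Fin (k + 1) => ℝ) 0
  have he : MeasurePreserving e := volume_preserving_piFinSuccAbove (fun _ : Fin (k + 1) => ℝ) 0
  let S : Set (ℝ × (Fin k → ℝ)) := {p | 0 < p.1 ∧ p.2 ∈ sojournSet k (T - p.1)}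
  have hS : MeasurableSet S := by
    have h1 : MeasurableSet {p : ℝ × (Fin k → ℝ) | 0 < p.1} :=
      measurableSet_lt measurable_const measurable_fst
    have h2 : MeasurableSet {p : ℝ × (Fin k → ℝ) | p.2 ∈ sojournSet k (T - p.1)} := by
      have : {p : ℝ × (Fin k → ℝ) | p.2 ∈ sojournSet k (T - p.1)} =
          (⋂ i, {p | 0 < p.2 i}) ∩ {p | ∑ i, p.2 i + p.1 < T} := by
        ext p
        simp [sojournSet, lt_sub_iff_add_lt]
      rw [this]
      refine (MeasurableSet.iInter fun i => ?_).inter ?_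
      · exact measurableSet_lt measurable_const ((measurable_pi_apply i).comp measurable_snd)
      · exact measurableSet_lt
          ((Finset.measurable_sum _ fun i _ => (measurable_pi_apply i).comp measurable_snd).add
            measurable_fst) measurable_const
    exact h1.inter h2
  have hpre : e ⁻¹' S = sojournSet (k + 1) T := by
    ext s
    have he' : e s = (s 0, fun j => s j.succ) := rfl
    simp only [S, mem_preimage, mem_setOf_eq, he', sojournSet, Fin.forall_fin_succ (P := fun i => 0 < s i),
      Fin.sum_univ_succ]
    constructor
    · rintro ⟨h0, hpos, hsum⟩
      exact ⟨⟨h0, hpos⟩, by linarith⟩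
    · rintro ⟨⟨h0, hpos⟩, hsum⟩
      exact ⟨h0, hpos, by linarith⟩
  rw [← hpre, he.measure_preimage hS.nullMeasurableSet, Measure.volume_eq_prod,
    Measure.prod_apply hS]
  have hfib : ∀ a : ℝ, volume (Prod.mk a ⁻¹' S) =
      (Ioi (0 : ℝ)).indicator (fun a => volume (sojournSet k (T - a))) a := by
    intro a
    by_cases ha : 0 < a
    · rw [indicator_of_mem (mem_Ioi.2 ha)]
      congr 1
      ext t
      simp [S, ha]
    · rw [indicator_of_notMem (by simpa using ha)]
      have : Prod.mk a ⁻¹' S = ∅ := by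
        ext t
        simp [S, ha]
      rw [this, measure_empty]
  simp_rw [hfib]
  rw [lintegral_indicator measurableSet_Ioi]


/-- The volume of the sojourn simplex: `|Δ_k(T)| = T^k/k!` for `T > 0` (and `Δ_k(T) = ∅` for
`T ≤ 0`). [folklore] -/
theorem volume_sojournSet (k : ℕ) (T : ℝ) :
    volume (sojournSet k T) = if 0 < T then ENNReal.ofReal (T ^ k / k !) else 0 := by
  induction k generalizing T with
  | zero =>
    split_ifs with hT
    · rw [volume_sojournSet_zero hT]; simp
    · rw [sojournSet_eq_empty_of_nonpos (not_lt.1 hT), measure_empty]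
  | succ k ih =>
    rw [volume_sojournSet_succ]
    have hint : ∀ a : ℝ, volume (sojournSet k (T - a)) =
        (Iio T).indicator (fun a => ENNReal.ofReal ((T - a) ^ k / k !)) a := by
      intro a
      rw [ih]
      by_cases ha : a < T
      · rw [if_pos (sub_pos.2 ha), indicator_of_mem (mem_Iio.2 ha)]
      · rw [if_neg (by linarith), indicator_of_notMem (by simpa using ha)]
    simp_rw [hint]
    rw [lintegral_indicator measurableSet_Iio, Measure.restrict_restrict measurableSet_Iio,
      Iio_inter_Ioi]
    split_ifs with hT
    · have hcont : Continuous fun a : ℝ => (T - a) ^ k / k ! := by fun_prop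
      have hint_eq : ∫ a in Ioo 0 T, (T - a) ^ k / k ! = T ^ (k + 1) / (k + 1)! := by
        rw [← integral_Ioc_eq_integral_Ioo, ← intervalIntegral.integral_of_le hT.le,
          intervalIntegral.integral_div, intervalIntegral.integral_comp_sub_left (fun a => a ^ k) T]
        simp only [sub_self, sub_zero, integral_pow, ne_eq, Nat.add_eq_zero_iff, one_ne_zero,
          and_false, not_false_eq_true, zero_pow]
        rw [Nat.factorial_succ]
        push_cast
        field_simp
      rw [← hint_eq, ofReal_integral_eq_lintegral_ofReal]
      · exact (hcont.integrableOn_Icc (a := 0) (b := T)).mono_set Ioo_subset_Icc_self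
      · refine (ae_restrict_iff' measurableSet_Ioo).2 (Eventually.of_forall fun a ha => ?_)
        exact div_nonneg (pow_nonneg (sub_pos.2 ha.2).le _) (Nat.cast_nonneg _)
    · rw [Ioo_eq_empty hT, Measure.restrict_empty, lintegral_zero_measure]


/-! ### The path integral: `∫_{Δ} e^{-gI} ≤ |Δ|`, with equality at `g = 0` -/

/-- On the sojourn simplex all `k + 1` sojourn times (including the terminal one `T - Σ s`) are
positive. [folklore] -/
theorem sojourns_pos {k : ℕ} {T : ℝ} {s : Fin k → ℝ} (hs : s ∈ sojournSet k T)
    (i : Fin (k + 1)) : 0 < sojourns T s i := by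
  unfold sojourns
  induction i using Fin.lastCases with
  | last => simpa [Fin.snoc_last] using sub_pos.2 hs.2
  | cast j => simpa [Fin.snoc_castSucc] using hs.1 j

/-- The self-intersection local time is non-negative on the sojourn simplex. [folklore] -/
theorem selfIntersection_nonneg {x : Site d} (ω : (zdGraph d).Walk 0 x) {T : ℝ}
    {s : Fin ω.length → ℝ} (hs : s ∈ sojournSet ω.length T) : 0 ≤ selfIntersection T ω s := by
  unfold selfIntersection
  refine Finset.sum_nonneg fun i _ => Finset.sum_nonneg fun j _ => ?_
  split_ifs
  · exact (mul_pos (sojourns_pos hs i) (sojourns_pos hs j)).le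
  · exact le_rfl

/-- `∫_{Δ_k(T)} e^{-gI} ds ≤ |Δ_k(T)|` for `g ≥ 0` (`I ≥ 0`). [folklore] -/
theorem pathIntegral_le_volume {g : ℝ} (hg : 0 ≤ g) (T : ℝ) {x : Site d}
    (ω : (zdGraph d).Walk 0 x) : pathIntegral g T ω ≤ volume (sojournSet ω.length T) := by
  unfold pathIntegral
  calc ∫⁻ s in sojournSet ω.length T, ENNReal.ofReal (Real.exp (-g * selfIntersection T ω s))
      ≤ ∫⁻ _ in sojournSet ω.length T, 1 := by
        refine setLIntegral_mono measurable_const fun s hs => ?_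
        rw [ENNReal.ofReal_le_one, Real.exp_le_one_iff]
        nlinarith [selfIntersection_nonneg ω hs]
    _ = volume (sojournSet ω.length T) := setLIntegral_one _

/-- At `g = 0` the path integral is the volume of the sojourn simplex. [folklore] -/
theorem pathIntegral_zero_left (T : ℝ) {x : Site d} (ω : (zdGraph d).Walk 0 x) :
    pathIntegral 0 T ω = volume (sojournSet ω.length T) := by
  simp [pathIntegral]

/-! ### Counting nearest-neighbour walks: first-step recursion, `(2d)^k` walks from the origin -/

section WalkCount

variable {V : Type*} [DecidableEq V] (G : SimpleGraph V) [G.LocallyFinite]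

/-- Zero-step walks: one from `u` to `u`, none to `v ≠ u`. [folklore] -/
theorem card_finsetWalkLength_zero (u v : V) :
    (G.finsetWalkLength 0 u v).card = if u = v then 1 else 0 := by
  split_ifs with h
  · subst h
    simp [SimpleGraph.finsetWalkLength]
  · simp [SimpleGraph.finsetWalkLength, h]

/-- First-step decomposition: the `n+1`-step walks from `u` to `v` are counted by summing the
`n`-step walks from the neighbours of `u`. [folklore] -/
theorem card_finsetWalkLength_succ (n : ℕ) (u v : V) :
    (G.finsetWalkLength (n + 1) u v).card =
      ∑ w ∈ G.neighborFinset u, (G.finsetWalkLength n w v).card := by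
  have hdef : G.finsetWalkLength (n + 1) u v = Finset.univ.biUnion fun (w : G.neighborSet u) =>
      (G.finsetWalkLength n w v).map ⟨fun p => SimpleGraph.Walk.cons w.property p,
        fun _ _ => by simp⟩ := rfl
  rw [hdef, Finset.card_biUnion]
  · simp only [Finset.card_map]
    exact (Finset.sum_subtype (G.neighborFinset u) (fun w => G.mem_neighborFinset u w)
      (fun w => (G.finsetWalkLength n w v).card)).symm
  · intro w₁ _ w₂ _ hne
    rw [Function.onFun, Finset.disjoint_left]
    intro p hp₁ hp₂
    rw [Finset.mem_map] at hp₁ hp₂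
    obtain ⟨q₁, -, rfl⟩ := hp₁
    obtain ⟨q₂, -, hq⟩ := hp₂
    have h1 := congrArg (fun p : G.Walk u v => p.getVert 1) hq
    simp only [Function.Embedding.coeFn_mk, SimpleGraph.Walk.getVert_cons_succ,
      SimpleGraph.Walk.getVert_zero] at h1
    exact hne (Subtype.ext h1.symm)

/-- Bounded degree `≤ D` gives at most `D^n` walks of length `n` from any vertex (counted over any
finite set of endpoints). [folklore] -/
theorem sum_card_finsetWalkLength_le {D : ℕ} (hD : ∀ v, G.degree v ≤ D) (n : ℕ) :
    ∀ (u : V) (X : Finset V), ∑ x ∈ X, (G.finsetWalkLength n u x).card ≤ D ^ n := by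
  induction n with
  | zero =>
    intro u X
    simp only [card_finsetWalkLength_zero, pow_zero, Finset.sum_ite_eq]
    split_ifs <;> simp
  | succ n ih =>
    intro u X
    calc ∑ x ∈ X, (G.finsetWalkLength (n + 1) u x).card
        = ∑ w ∈ G.neighborFinset u, ∑ x ∈ X, (G.finsetWalkLength n w x).card := by
          simp_rw [card_finsetWalkLength_succ]; exact Finset.sum_comm
      _ ≤ ∑ _w ∈ G.neighborFinset u, D ^ n := Finset.sum_le_sum fun w _ => ih w X
      _ = G.degree u * D ^ n := by
          rw [Finset.sum_const, smul_eq_mul, SimpleGraph.card_neighborFinset_eq_degree]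
      _ ≤ D * D ^ n := Nat.mul_le_mul_right _ (hD u)
      _ = D ^ (n + 1) := by ring

/-- Regular degree `D` gives exactly `D^n` walks of length `n` from `u`, counted over any finite
set containing all their endpoints. [folklore] -/
theorem sum_card_finsetWalkLength_eq {D : ℕ} (hreg : ∀ v, G.degree v = D) (n : ℕ) :
    ∀ (u : V) (X : Finset V), (∀ (x : V) (p : G.Walk u x), p.length = n → x ∈ X) →
      ∑ x ∈ X, (G.finsetWalkLength n u x).card = D ^ n := by
  induction n with
  | zero =>
    intro u X hX
    have hu : u ∈ X := hX u SimpleGraph.Walk.nil rfl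
    simp only [card_finsetWalkLength_zero, pow_zero, Finset.sum_ite_eq, if_pos hu]
  | succ n ih =>
    intro u X hX
    calc ∑ x ∈ X, (G.finsetWalkLength (n + 1) u x).card
        = ∑ w ∈ G.neighborFinset u, ∑ x ∈ X, (G.finsetWalkLength n w x).card := by
          simp_rw [card_finsetWalkLength_succ]; exact Finset.sum_comm
      _ = ∑ _w ∈ G.neighborFinset u, D ^ n := by
          refine Finset.sum_congr rfl fun w hw => ih w X fun x p hp => ?_
          exact hX x (SimpleGraph.Walk.cons ((G.mem_neighborFinset u w).1 hw) p)
            (by rw [SimpleGraph.Walk.length_cons, hp])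
      _ = D ^ (n + 1) := by
          rw [Finset.sum_const, smul_eq_mul, SimpleGraph.card_neighborFinset_eq_degree, hreg u]
          ring

end WalkCount

/-- The `2d` neighbours of a site of `ℤ^d`: `x ± eᵢ`. [folklore] -/
theorem neighborFinset_zdGraph_eq (x : Site d) :
    (zdGraph d).neighborFinset x = (Finset.univ : Finset (Fin d × Bool)).image
      (fun p => if p.2 then x + Pi.single p.1 1 else x - Pi.single p.1 1) := by
  ext y
  simp only [SimpleGraph.mem_neighborFinset, Finset.mem_image, Finset.mem_univ, true_and,
    zdGraph_adj_iff]
  constructor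
  · rintro ⟨i, h | h⟩
    · exact ⟨(i, true), by simp [h]⟩
    · exact ⟨(i, false), by simp [h]⟩
  · rintro ⟨⟨i, b⟩, rfl⟩
    cases b
    · exact ⟨i, Or.inr (by simp)⟩
    · exact ⟨i, Or.inl (by simp)⟩

/-- The map `(i, ±) ↦ x ± eᵢ` is injective. [folklore] -/
theorem step_injective (x : Site d) : Function.Injective
    (fun p : Fin d × Bool => if p.2 then x + Pi.single p.1 (1 : ℤ) else x - Pi.single p.1 1) := by
  rintro ⟨i, b⟩ ⟨j, c⟩ h
  have hi := congrFun h i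
  have hj := congrFun h j
  cases b <;> cases c <;>
    simp only [Bool.false_eq_true, ↓reduceIte, Pi.sub_apply, Pi.add_apply, Pi.single_apply]
      at hi hj <;> split_ifs at hi hj with h1 h2 <;> first | (subst_vars; rfl) | omega

/-- Every site of `ℤ^d` has exactly `2d` neighbours (the content of the named fact
`Literature.Probability.LatticeModels.card_neighborFinset_zdGraph`). [folklore] -/
theorem degree_zdGraph_eq (x : Site d) : (zdGraph d).degree x = 2 * d := by
  rw [← SimpleGraph.card_neighborFinset_eq_degree, neighborFinset_zdGraph_eq,
    Finset.card_image_of_injective _ (step_injective x)]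
  simp [mul_comm]

/-- There are exactly `(2d)^n` nearest-neighbour walks of length `n` from the origin of `ℤ^d`
(all ending in `box d n`). [folklore] -/
theorem sum_card_finsetWalkLength_zdGraph (d n : ℕ) :
    ∑ x ∈ box d n, ((zdGraph d).finsetWalkLength n 0 x).card = (2 * d) ^ n :=
  sum_card_finsetWalkLength_eq _ degree_zdGraph_eq n 0 (box d n) fun _ p hp =>
    Literature.Probability.RandomPlanarGeometry.SAW.Zd.mem_box_of_walk p hp.le

/-- At most `(2d)^n` walks of length `n` from any site, over any finite set of endpoints.
[folklore] -/
theorem sum_card_finsetWalkLength_zdGraph_le (d n : ℕ) (u : Site d) (X : Finset (Site d)) :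
    ∑ x ∈ X, ((zdGraph d).finsetWalkLength n u x).card ≤ (2 * d) ^ n :=
  sum_card_finsetWalkLength_le _ (fun v => (degree_zdGraph_eq v).le) n u X


/-! ### Total mass of the jump-chain representation: `c_{0,T} = 1` and `c_{g,T} ≤ 1` -/

/-- The `k`-jump layer at `g = 0`: `Σ_x Σ_{|ω| = k} |Δ_k(T)| = (2d)^k T^k/k!`. [folklore] -/
theorem layer_zero (d k : ℕ) {T : ℝ} (hT : 0 < T) :
    ∑ x ∈ box d k, ∑ ω ∈ (zdGraph d).finsetWalkLength k (0 : Site d) x, pathIntegral 0 T ω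
      = (2 * d : ℝ≥0∞) ^ k * ENNReal.ofReal (T ^ k / k !) := by
  have h : ∀ x ∈ box d k, ∀ ω ∈ (zdGraph d).finsetWalkLength k (0 : Site d) x,
      pathIntegral 0 T ω = ENNReal.ofReal (T ^ k / k !) := by
    intro x _ ω hω
    rw [pathIntegral_zero_left, volume_sojournSet, if_pos hT,
      SimpleGraph.mem_finsetWalkLength_iff.1 hω]
  rw [Finset.sum_congr rfl fun x hx => Finset.sum_congr rfl (h x hx)]
  simp only [Finset.sum_const, nsmul_eq_mul]
  rw [← Finset.sum_mul]
  congr 1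
  rw [← Nat.cast_sum, sum_card_finsetWalkLength_zdGraph]
  push_cast
  rfl

/-- The `k`-jump layer for `g ≥ 0` and a weight `Φ ≤ 1` is at most `(2d)^k T^k/k!`. [folklore] -/
theorem layer_le (d k : ℕ) {g : ℝ} (hg : 0 ≤ g) {T : ℝ} (hT : 0 < T) {Φ : Site d → ℝ≥0∞}
    (hΦ : ∀ x, Φ x ≤ 1) :
    ∑ x ∈ box d k, ∑ ω ∈ (zdGraph d).finsetWalkLength k (0 : Site d) x, Φ x * pathIntegral g T ω
      ≤ (2 * d : ℝ≥0∞) ^ k * ENNReal.ofReal (T ^ k / k !) := by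
  calc ∑ x ∈ box d k, ∑ ω ∈ (zdGraph d).finsetWalkLength k (0 : Site d) x, Φ x * pathIntegral g T ω
      ≤ ∑ x ∈ box d k, ∑ ω ∈ (zdGraph d).finsetWalkLength k (0 : Site d) x,
          pathIntegral 0 T ω := by
        refine Finset.sum_le_sum fun x _ => Finset.sum_le_sum fun ω _ => ?_
        calc Φ x * pathIntegral g T ω ≤ 1 * pathIntegral g T ω := mul_le_mul' (hΦ x) le_rfl
          _ = pathIntegral g T ω := one_mul _
          _ ≤ volume (sojournSet ω.length T) := pathIntegral_le_volume hg T ω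
          _ = pathIntegral 0 T ω := (pathIntegral_zero_left T ω).symm
    _ = _ := layer_zero d k hT

/-- The cast `(2d : ℝ≥0∞) = ofReal (2d)`. [folklore] -/
theorem two_mul_natCast_eq_ofReal (d : ℕ) : (2 * d : ℝ≥0∞) = ENNReal.ofReal (2 * d : ℝ) := by
  rw [ENNReal.ofReal_mul (by norm_num), ENNReal.ofReal_ofNat, ENNReal.ofReal_natCast]

/-- `Σ_k (2d)^k T^k/k! = e^{2dT}` in `ℝ≥0∞` (the Poisson normalisation). [folklore] -/
theorem tsum_layer_zero (d : ℕ) {T : ℝ} (hT : 0 ≤ T) :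
    ∑' k : ℕ, (2 * d : ℝ≥0∞) ^ k * ENNReal.ofReal (T ^ k / k !)
      = ENNReal.ofReal (Real.exp (2 * d * T)) := by
  have h1 : ∀ k : ℕ, (2 * d : ℝ≥0∞) ^ k * ENNReal.ofReal (T ^ k / k !)
      = ENNReal.ofReal ((2 * d * T) ^ k / k !) := by
    intro k
    rw [two_mul_natCast_eq_ofReal, ← ENNReal.ofReal_pow (by positivity),
      ← ENNReal.ofReal_mul (by positivity)]
    congr 1
    ring
  simp_rw [h1]
  rw [← ENNReal.ofReal_tsum_of_nonneg (fun k => by positivity) (Real.summable_pow_div_factorial _)]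
  congr 1
  rw [Real.exp_eq_exp_ℝ]
  exact (NormedSpace.expSeries_div_hasSum_exp (2 * d * T)).tsum_eq

/-- `E₀[e^{-gI(T)} Φ(X(T))] ≤ 1` for `g ≥ 0` and `Φ ≤ 1`. [folklore] -/
theorem weightedExpectation_le_one {g : ℝ} (hg : 0 ≤ g) {T : ℝ} (hT : 0 < T) {Φ : Site d → ℝ≥0∞}
    (hΦ : ∀ x, Φ x ≤ 1) : weightedExpectation d g T Φ ≤ 1 := by
  unfold weightedExpectation
  calc ENNReal.ofReal (Real.exp (-(2 * d) * T)) *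
        ∑' k, ∑ x ∈ box d k, ∑ ω ∈ (zdGraph d).finsetWalkLength k (0 : Site d) x,
          Φ x * pathIntegral g T ω
      ≤ ENNReal.ofReal (Real.exp (-(2 * d) * T)) *
          ∑' k, (2 * d : ℝ≥0∞) ^ k * ENNReal.ofReal (T ^ k / k !) :=
        mul_le_mul' le_rfl (ENNReal.tsum_le_tsum fun k => layer_le d k hg hT hΦ)
    _ = 1 := by
        rw [tsum_layer_zero d hT.le, ← ENNReal.ofReal_mul (Real.exp_pos _).le, ← Real.exp_add]
        norm_num

/-- The jump-chain representation is correctly normalised: at `g = 0`, `c_{0,T} = E₀[1] = 1`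
(`e^{-2dT} Σ_k (2d)^k T^k/k! = 1`). [cite: BauerschmidtBrydgesSlade2015LogCorr, §1.1 (c_T at g = 0)] -/
theorem survival_zero_left (d : ℕ) {T : ℝ} (hT : 0 < T) : survival d 0 T = 1 := by
  unfold survival weightedExpectation
  simp_rw [one_mul, layer_zero d _ hT]
  rw [tsum_layer_zero d hT.le, ← ENNReal.ofReal_mul (Real.exp_pos _).le, ← Real.exp_add]
  norm_num

/-- `c_{g,T} = E₀(e^{-gI(T)}) ≤ 1` for `g ≥ 0` ("obvious from `I ≥ 0`").
[cite: BauerschmidtBrydgesSlade2015LogCorr, Lemma A.1 (proof)] -/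
theorem survival_le_one {g : ℝ} (hg : 0 ≤ g) (d : ℕ) {T : ℝ} (hT : 0 < T) : survival d g T ≤ 1 :=
  weightedExpectation_le_one hg hT fun _ => le_rfl

/-! ### The susceptibility: monotone in `ν`, finite for `ν > 0`; hence `ν_c ≤ 0` -/

/-- `χ(g, ·)` is non-increasing in `ν`. [folklore] -/
theorem susceptibility_antitone (d : ℕ) (g : ℝ) : Antitone (susceptibility d g) := by
  intro ν₁ ν₂ h
  unfold susceptibility
  refine setLIntegral_mono' measurableSet_Ioi fun T hT => mul_le_mul' le_rfl ?_
  exact ENNReal.ofReal_le_ofReal (Real.exp_le_exp.2 (by nlinarith [mem_Ioi.1 hT]))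

/-- `χ(g,ν) ≤ 1/ν < ∞` for `ν > 0` and `g ≥ 0` (from `c_T ≤ 1`).
[cite: BauerschmidtBrydgesSlade2015LogCorr, Lemma A.1 (proof: ν_c ≤ 0)] -/
theorem susceptibility_lt_top {g : ℝ} (hg : 0 ≤ g) (d : ℕ) {ν : ℝ} (hν : 0 < ν) :
    susceptibility d g ν < ∞ := by
  unfold susceptibility
  calc ∫⁻ T in Ioi (0 : ℝ), survival d g T * ENNReal.ofReal (Real.exp (-ν * T))
      ≤ ∫⁻ T in Ioi (0 : ℝ), ENNReal.ofReal (Real.exp (-ν * T)) := by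
        refine setLIntegral_mono' measurableSet_Ioi fun T hT => ?_
        calc survival d g T * ENNReal.ofReal (Real.exp (-ν * T))
            ≤ 1 * ENNReal.ofReal (Real.exp (-ν * T)) :=
              mul_le_mul' (survival_le_one hg d (mem_Ioi.1 hT)) le_rfl
          _ = _ := one_mul _
    _ < ∞ := (exp_neg_integrableOn_Ioi 0 hν).lintegral_lt_top

/-- **`ν_c ≤ 0`** (Lemma A.1, first clause, for every `d` and `g ≥ 0`): `χ(g,ν) < ∞` for all
`ν > 0`. [cite: BauerschmidtBrydgesSlade2015LogCorr, Lemma A.1] -/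
theorem criticalNu_le_zero {g : ℝ} (hg : 0 ≤ g) (d : ℕ) : criticalNu d g ≤ 0 := by
  unfold criticalNu
  by_cases hS : BddBelow {ν : ℝ | susceptibility d g ν < ∞}
  · refine le_of_forall_pos_le_add fun ε hε => ?_
    rw [zero_add]
    exact csInf_le hS (susceptibility_lt_top hg d hε)
  · rw [Real.sInf_of_not_bddBelow hS]

/-- Above `ν_c` the susceptibility is finite (`g ≥ 0`).
[cite: BauerschmidtBrydgesSlade2015LogCorr, Lemma A.1] -/
theorem susceptibility_lt_top_of_criticalNu_lt {g : ℝ} (hg : 0 ≤ g) {ν : ℝ}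
    (hν : criticalNu d g < ν) : susceptibility d g ν < ∞ := by
  have hne : {ν : ℝ | susceptibility d g ν < ∞}.Nonempty := ⟨1, susceptibility_lt_top hg d one_pos⟩
  obtain ⟨ν', hν'S, hν'⟩ := exists_lt_of_csInf_lt hne hν
  exact lt_of_le_of_lt (susceptibility_antitone d g hν'.le) hν'S

/-- Below `ν_c` the susceptibility is infinite, provided `{ν | χ(g,ν) < ∞}` is bounded below
(which is where the lower bound of Lemma A.1 enters). [cite: BauerschmidtBrydgesSlade2015LogCorr, Lemma A.1] -/
theorem susceptibility_eq_top_of_lt_criticalNu {g ν : ℝ}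
    (hS : BddBelow {ν : ℝ | susceptibility d g ν < ∞}) (hν : ν < criticalNu d g) :
    susceptibility d g ν = ∞ := by
  by_contra h
  exact not_le.2 hν (csInf_le hS (lt_top_iff_ne_top.2 h))

end Literature.Barriers.CriticalPhenomena.CTWSAW
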